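import Summits.QuantumFields.YangMills.Theorems.UnitScaleTiltProp7SymFrameRem2RowOfN32SymT3
import Summits.QuantumFields.YangMills.Theorems.UnitScaleTiltProp7CombFrameRem2RowOfCombRowsT3
import HarnessLib

/-!
# Route `UnitScaleTilt`, crux K1 «MinimiserStabilityRegPr» (stmt-QuantumFields-19200), route-R E′ (A′)-on-Σ, P-A2 row (β) of ✓p698006 — file «(β)-ASSEMBLY G3»:
# **THE `hD` BINDER FROM EXACTLY THE THREE OWNER-LABELLED ROUTE-INTERNAL ROWS `hMcomb`, `hMcomb₂`, «(n3)₂-sym»** (★★OWNER RULING №20 (1) + px13 g6's verdict that REM2ˢ needs (n3)₂-sym):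
# `hD_of_hMcomb (hMc) (hMc₂) (hN2s) : ⟨✓p698006's hD VERBATIM⟩ := hD_of_hMcomb_of_rem2Rows hMc (hRs_of_hN2s hN2s) (hRc_of_hMcomb_hMcomb₂ hMc hMc₂)` — one `exact` over ✓p705268 (B),
# ✓p706158 (G3-s, over px13 ✓p705339) and G3-c (over px17 F-γᶜ3c).

Cell `ym3-torus` (HUMAN RULING D-0037: YM₃ on the torus is ladder rung R3 — not d = 4, not a mass gap, not Clay), width seat `ym3-torus-px16` (gen 5).  `--supports stmt-QuantumFields-19200
--as helper`; THEOREMS ONLY (0 `def`, 0 `sorry`); count-neutral.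

DISPLAYED ROWS (all OPEN, route-internal, L; lane (II) ★routeR-w1 g9 F-0…F-8 ∕ H2-1 supplies `hMc`, `hMc₂`; the (n3)₂-sym supplier is the open analytic row named by px13 g6 07:18:54Z):
* `hMc` («hMcomb», ★routeR-w6 SIGNATURE-0 at `A := iX`): `∀ l < K − n, Σ_{z,κ} ‖Ũ^{(l)}_{z,κ}(iX) − 1‖² ≤ A·M·(Lˡ)⁻¹ + (B·(K+DIV) + B′·(ℓ²)⁻¹·M)·Lˡ`;
* `hMc₂` («hMcomb₂», px13 SIGNATURE-0′ at `A := iX`): `∀ l < K − n, Σ_{z,κ} ‖Ũ^{(l)}_{z,κ}(iX) − 1 − D[Ũ^{(l)}_{z,κ}](0)(iX)‖ ≤ A₂·M·(Lˡ)⁻¹ + (B₂·(K+DIV) + B₂′·(ℓ²)⁻¹·M)·Lˡ`;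
* `hN2s` («(n3)₂-sym», px13 ✓p705339's `hR`∕`hRs` at `D := X`): `∀ l < K − n, Σ_{b : PBond (F.P K) l} ‖pertVar Ūˡ[W] Ūˡ[e^{iX}W] b − D[Ū⁽ˡ⁾(e^{·}W♭) b](0)(iX)·(Ūˡ[W] b)⋆‖ ≤ A₃·M·(Lˡ)⁻¹ + (B₃·(K+DIV) + B₃′·(ℓ²)⁻¹·M)·Lˡ`.

HONEST SCOPE.  Assembly (one `exact`); the three displayed rows are OPEN; nothing of (β)'s analytic content, hPA2, hcoS, E′, EX or the crux is proved here; YM₃ on T³ is rung R3 — NOT d = 4,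
NOT infinite volume, NOT a mass gap, NOT Clay.
[cite: Balaban1985Variational, (2) p.278, (19)-(20) p.281, (44)-(48) pp.285-286, (106)-(111) p.294; Balaban1985Averaging, (89)-(92) p.31, (97) p.32, (122)-(126) p.36]
-/

noncomputable section

open scoped BigOperators Matrix.Norms.L2Operator Matrix Topology InnerProductSpace
open Filter NormedSpace

namespace Summit.QuantumFields.YangMills.Theorems.Prop7HDOfCombRows

open Literature.MathematicalPhysics.QuantumFieldTheory.Balaban1983to89
open Literature.MathematicalPhysics.QuantumFieldTheory.Balaban1983to89.T3ContinuumYM3Torus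
open Literature.MathematicalPhysics.QuantumFieldTheory.Balaban1983to89.T3UnitLawDensityEML (ℰp)
open Literature.MathematicalPhysics.QuantumFieldTheory.Balaban1983to89.T3ConstrainedMinimiser (fibre)
open Literature.MathematicalPhysics.QuantumFieldTheory.Balaban1983to89.T3PrintedRegularMinimiser
open Literature.MathematicalPhysics.QuantumFieldTheory.Balaban1983to89.T3RegularMinimiser
open Literature.MathematicalPhysics.QuantumFieldTheory.Balaban1983to89.T3Thm1Carrier
open T4Continuum T4ReflectionCone BlockAveraging AveragingRT ExpMeanLog BlockAveragingEMLLinearised BlockAveragingEMLLinearisedBackground BlockAveragingEMLProp2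
open B7Prop1Explicit (expUnit)
open B7Eq92Concrete (tildIter)
open B10Eq27TorusAxialLog (pull unitsField toUField)
open B9Eq39Adjoint (divB)
open B9TorusCalculus (torusT)
open T3SectALandauChart (emb15 eta bgUnits In19)
open B11Eq103H1Complex (BondL2K laplaceAK)
open Summit.QuantumFields.YangMills.Theorems.Prop8Chart (emlIterU)
open Summit.QuantumFields.YangMills.Theorems.Prop7SPrint (basePt RestrictedPrint AvgCondPrint IsLandauPrint)
open Summit.QuantumFields.YangMills.Theorems.Prop7TPrint (expHermField)
open Summit.QuantumFields.YangMills.Theorems.Prop7SymAvgTw (frameTw QTw CmapTw)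
open Summit.QuantumFields.YangMills.Theorems.Prop7SymAvgTwSym (frameTwS CmapTwS)
open Summit.QuantumFields.YangMills.Theorems.Prop7HDOfCombRowRem2Rows (hD_of_hMcomb_of_rem2Rows)
open Summit.QuantumFields.YangMills.Theorems.Prop7SymFrameRem2RowOfN32Sym (hRs_of_hN2s)
open Summit.QuantumFields.YangMills.Theorems.Prop7CombFrameRem2RowOfCombRows (hRc_of_hMcomb_hMcomb₂)

/-- ★★★ **✓p698006's (β) ROW `hD` FROM EXACTLY {`hMcomb`, `hMcomb₂`, «(n3)₂-sym»}** — conclusion = the `hD` binder of ✓`Prop7PA2OfSymDiffDivRows.hPA2_of_symL1_diffL1_divSlice`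
VERBATIM; hypotheses = the three displayed OPEN route-internal rows (docstring above); proof = one `exact` over B ✓p705268, G3-s ✓p706158, G3-c.
[cite: Balaban1985Variational, (2) p.278, (19)-(20) p.281, (44)-(48) pp.285-286, (106)-(111) p.294; Balaban1985Averaging, (89)-(92) p.31, (97) p.32] -/
theorem hD_of_hMcomb
    (hMc : ∀ (L : ℕ), 1 < L → ∀ (B₁' : ℝ), 0 < B₁' → ∃ eC A B B' : ℝ, 0 < eC ∧ 0 ≤ A ∧ 0 ≤ B ∧ 0 ≤ B' ∧
      ∀ (F : T3Family), F.L = L → ∀ (n K : ℕ) (hnK : n < K) (e : ℝ) (V : GaugeField (F.P n) 0 (Matrix.specialUnitaryGroup (Fin 2) ℂ))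
        (W : GaugeField (F.P K) 0 (Matrix.specialUnitaryGroup (Fin 2) ℂ)) (X : PBond (F.P K) 0 → Matrix (Fin 2) (Fin 2) ℂ),
        0 < e → e ≤ eC → W ∈ regFibrePr F n K hnK.le e V →
        (∀ γ : ℝ → GaugeField (F.P K) 0 (Matrix.specialUnitaryGroup (Fin 2) ℂ), γ 0 = W → (∀ t, γ t ∈ fibre F ℰp n K hnK.le V) →
          (∀ b, DifferentiableAt ℝ (fun t => ((γ t b : Matrix.specialUnitaryGroup (Fin 2) ℂ) : Matrix (Fin 2) (Fin 2) ℂ)) 0) →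
            deriv (fun t => wilsonAction4 (γ t)) 0 = 0) →
        In19 F n K (2 * B₁' * e) W (expHermField X) X → AvgCondPrint F n K hnK.le V W X → IsLandauPrint F n K W X →
          ∀ l : ℕ, l < K - n →
            ∑ z : Site (F.P K) l, ∑ κ : Fin (F.P K).d,
              ‖((tildIter (F.P K).L (pull (bgUnits F K W) (basePt F n K)) (pull (fun b => expUnit (Complex.I • X b)) (basePt F n K)) l
              (fun μ => ((z μ).val : ℤ)) κ : (Matrix (Fin 2) (Fin 2) ℂ)ˣ) : Matrix (Fin 2) (Fin 2) ℂ) - 1‖ ^ 2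
              ≤ A * (∑ b : PBond (F.P K) 0, ‖X b‖ ^ 2) * ((F.L : ℝ) ^ l)⁻¹
                + (B * ((∑ p : Plaq (F.P K) 0, ‖((Complex.I • X ⟨p.src, p.μ⟩) + ((W ⟨p.src, p.μ⟩ : Matrix (Fin 2) (Fin 2) ℂ) * (Complex.I • X ⟨p.src.shift p.μ, p.ν⟩) * star (W ⟨p.src, p.μ⟩ : Matrix (Fin 2) (Fin 2) ℂ))
            - (((W ⟨p.src, p.μ⟩ * W ⟨p.src.shift p.μ, p.ν⟩ * (W ⟨p.src.shift p.ν, p.μ⟩)⁻¹ : Matrix.specialUnitaryGroup (Fin 2) ℂ) : Matrix (Fin 2) (Fin 2) ℂ) * (Complex.I • X ⟨p.src.shift p.ν, p.μ⟩) * star ((W ⟨p.src, p.μ⟩ * W ⟨p.src.shift p.μ, p.ν⟩ * (W ⟨p.src.shift p.ν, p.μ⟩)⁻¹ : Matrix.specialUnitaryGroup (Fin 2) ℂ) : Matrix (Fin 2) (Fin 2) ℂ))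
            - (((GaugeField.plaqHol W p : Matrix.specialUnitaryGroup (Fin 2) ℂ) : Matrix (Fin 2) (Fin 2) ℂ) * (Complex.I • X ⟨p.src, p.ν⟩) * star ((GaugeField.plaqHol W p : Matrix.specialUnitaryGroup (Fin 2) ℂ) : Matrix (Fin 2) (Fin 2) ℂ)))‖ ^ 2) + (∑ x : Site (F.P K) 0, ∑ j : Fin 2, ∑ k : Fin 2,
              ‖(divB (torusT (F.P K) 0) (fun κ z => unitsField (toUField W) ⟨z, κ⟩) (fun κ z => Complex.I • X ⟨z, κ⟩) x) j k‖ ^ 2))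
                  + B' * (((F.L : ℝ) ^ (K - n)) ^ 2)⁻¹ * (∑ b : PBond (F.P K) 0, ‖X b‖ ^ 2)) * (F.L : ℝ) ^ l)
    (hMc₂ : ∀ (L : ℕ), 1 < L → ∀ (B₁' : ℝ), 0 < B₁' → ∃ e₂ A₂ B₂ B₂' : ℝ, 0 < e₂ ∧ 0 ≤ A₂ ∧ 0 ≤ B₂ ∧ 0 ≤ B₂' ∧
      ∀ (F : T3Family), F.L = L → ∀ (n K : ℕ) (hnK : n < K) (e : ℝ) (V : GaugeField (F.P n) 0 (Matrix.specialUnitaryGroup (Fin 2) ℂ))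
        (W : GaugeField (F.P K) 0 (Matrix.specialUnitaryGroup (Fin 2) ℂ)) (X : PBond (F.P K) 0 → Matrix (Fin 2) (Fin 2) ℂ),
        0 < e → e ≤ e₂ → W ∈ regFibrePr F n K hnK.le e V →
        (∀ γ : ℝ → GaugeField (F.P K) 0 (Matrix.specialUnitaryGroup (Fin 2) ℂ), γ 0 = W → (∀ t, γ t ∈ fibre F ℰp n K hnK.le V) →
          (∀ b, DifferentiableAt ℝ (fun t => ((γ t b : Matrix.specialUnitaryGroup (Fin 2) ℂ) : Matrix (Fin 2) (Fin 2) ℂ)) 0) →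
            deriv (fun t => wilsonAction4 (γ t)) 0 = 0) →
        In19 F n K (2 * B₁' * e) W (expHermField X) X → AvgCondPrint F n K hnK.le V W X → IsLandauPrint F n K W X →
          ∀ l : ℕ, l < K - n →
            ∑ z : Site (F.P K) l, ∑ κ : Fin (F.P K).d,
              ‖((tildIter (F.P K).L (pull (bgUnits F K W) (basePt F n K)) (pull (fun b => expUnit (Complex.I • X b)) (basePt F n K)) l
              (fun μ => ((z μ).val : ℤ)) κ : (Matrix (Fin 2) (Fin 2) ℂ)ˣ) : Matrix (Fin 2) (Fin 2) ℂ) - 1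
            - (fderiv ℂ (fun A' : PBond (F.P K) 0 → Matrix (Fin 2) (Fin 2) ℂ =>
                ((tildIter (F.P K).L (pull (bgUnits F K W) (basePt F n K)) (pull (fun b => expUnit (A' b)) (basePt F n K)) l (fun μ => ((z μ).val : ℤ)) κ :
                  (Matrix (Fin 2) (Fin 2) ℂ)ˣ) : Matrix (Fin 2) (Fin 2) ℂ)) 0) (fun b => Complex.I • X b)‖
              ≤ A₂ * (∑ b : PBond (F.P K) 0, ‖X b‖ ^ 2) * ((F.L : ℝ) ^ l)⁻¹
                + (B₂ * ((∑ p : Plaq (F.P K) 0, ‖((Complex.I • X ⟨p.src, p.μ⟩) + ((W ⟨p.src, p.μ⟩ : Matrix (Fin 2) (Fin 2) ℂ) * (Complex.I • X ⟨p.src.shift p.μ, p.ν⟩) * star (W ⟨p.src, p.μ⟩ : Matrix (Fin 2) (Fin 2) ℂ))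
            - (((W ⟨p.src, p.μ⟩ * W ⟨p.src.shift p.μ, p.ν⟩ * (W ⟨p.src.shift p.ν, p.μ⟩)⁻¹ : Matrix.specialUnitaryGroup (Fin 2) ℂ) : Matrix (Fin 2) (Fin 2) ℂ) * (Complex.I • X ⟨p.src.shift p.ν, p.μ⟩) * star ((W ⟨p.src, p.μ⟩ * W ⟨p.src.shift p.μ, p.ν⟩ * (W ⟨p.src.shift p.ν, p.μ⟩)⁻¹ : Matrix.specialUnitaryGroup (Fin 2) ℂ) : Matrix (Fin 2) (Fin 2) ℂ))
            - (((GaugeField.plaqHol W p : Matrix.specialUnitaryGroup (Fin 2) ℂ) : Matrix (Fin 2) (Fin 2) ℂ) * (Complex.I • X ⟨p.src, p.ν⟩) * star ((GaugeField.plaqHol W p : Matrix.specialUnitaryGroup (Fin 2) ℂ) : Matrix (Fin 2) (Fin 2) ℂ)))‖ ^ 2) + (∑ x : Site (F.P K) 0, ∑ j : Fin 2, ∑ k : Fin 2,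
              ‖(divB (torusT (F.P K) 0) (fun κ z => unitsField (toUField W) ⟨z, κ⟩) (fun κ z => Complex.I • X ⟨z, κ⟩) x) j k‖ ^ 2))
                  + B₂' * (((F.L : ℝ) ^ (K - n)) ^ 2)⁻¹ * (∑ b : PBond (F.P K) 0, ‖X b‖ ^ 2)) * (F.L : ℝ) ^ l)
    (hN2s : ∀ (L : ℕ), 1 < L → ∀ (B₁' : ℝ), 0 < B₁' → ∃ e₃ A₃ B₃ B₃' : ℝ, 0 < e₃ ∧ 0 ≤ A₃ ∧ 0 ≤ B₃ ∧ 0 ≤ B₃' ∧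
      ∀ (F : T3Family), F.L = L → ∀ (n K : ℕ) (hnK : n < K) (e : ℝ) (V : GaugeField (F.P n) 0 (Matrix.specialUnitaryGroup (Fin 2) ℂ))
        (W : GaugeField (F.P K) 0 (Matrix.specialUnitaryGroup (Fin 2) ℂ)) (X : PBond (F.P K) 0 → Matrix (Fin 2) (Fin 2) ℂ),
        0 < e → e ≤ e₃ → W ∈ regFibrePr F n K hnK.le e V →
        (∀ γ : ℝ → GaugeField (F.P K) 0 (Matrix.specialUnitaryGroup (Fin 2) ℂ), γ 0 = W → (∀ t, γ t ∈ fibre F ℰp n K hnK.le V) →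
          (∀ b, DifferentiableAt ℝ (fun t => ((γ t b : Matrix.specialUnitaryGroup (Fin 2) ℂ) : Matrix (Fin 2) (Fin 2) ℂ)) 0) →
            deriv (fun t => wilsonAction4 (γ t)) 0 = 0) →
        In19 F n K (2 * B₁' * e) W (expHermField X) X → AvgCondPrint F n K hnK.le V W X → IsLandauPrint F n K W X →
          ∀ l : ℕ, l < K - n →
            ∑ b : PBond (F.P K) l,
              ‖pertVar (Averaging.iter (fun i => blockAvg (P := (F.P K)) (j := i) (expMeanLogSU (n := Fin 2))) l W)
                (Averaging.iter (fun i => blockAvg (P := (F.P K)) (j := i) (expMeanLogSU (n := Fin 2))) l (emb15 W (expHermField X))) b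
              - fderiv ℂ (fun t : PBond (F.P K) 0 → Matrix (Fin 2) (Fin 2) ℂ =>
                  ((emlIterU l (fun b' => expUnit (t b') * bgUnits F K W b') b : (Matrix (Fin 2) (Fin 2) ℂ)ˣ) : Matrix (Fin 2) (Fin 2) ℂ)) 0 (fun b' => Complex.I • X b')
                * star ((Averaging.iter (fun i => blockAvg (P := (F.P K)) (j := i) (expMeanLogSU (n := Fin 2))) l W b : Matrix.specialUnitaryGroup (Fin 2) ℂ) : Matrix (Fin 2) (Fin 2) ℂ)‖
              ≤ A₃ * (∑ b : PBond (F.P K) 0, ‖X b‖ ^ 2) * ((F.L : ℝ) ^ l)⁻¹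
                + (B₃ * ((∑ p : Plaq (F.P K) 0, ‖((Complex.I • X ⟨p.src, p.μ⟩) + ((W ⟨p.src, p.μ⟩ : Matrix (Fin 2) (Fin 2) ℂ) * (Complex.I • X ⟨p.src.shift p.μ, p.ν⟩) * star (W ⟨p.src, p.μ⟩ : Matrix (Fin 2) (Fin 2) ℂ))
            - (((W ⟨p.src, p.μ⟩ * W ⟨p.src.shift p.μ, p.ν⟩ * (W ⟨p.src.shift p.ν, p.μ⟩)⁻¹ : Matrix.specialUnitaryGroup (Fin 2) ℂ) : Matrix (Fin 2) (Fin 2) ℂ) * (Complex.I • X ⟨p.src.shift p.ν, p.μ⟩) * star ((W ⟨p.src, p.μ⟩ * W ⟨p.src.shift p.μ, p.ν⟩ * (W ⟨p.src.shift p.ν, p.μ⟩)⁻¹ : Matrix.specialUnitaryGroup (Fin 2) ℂ) : Matrix (Fin 2) (Fin 2) ℂ))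
            - (((GaugeField.plaqHol W p : Matrix.specialUnitaryGroup (Fin 2) ℂ) : Matrix (Fin 2) (Fin 2) ℂ) * (Complex.I • X ⟨p.src, p.ν⟩) * star ((GaugeField.plaqHol W p : Matrix.specialUnitaryGroup (Fin 2) ℂ) : Matrix (Fin 2) (Fin 2) ℂ)))‖ ^ 2) + (∑ x : Site (F.P K) 0, ∑ j : Fin 2, ∑ k : Fin 2,
              ‖(divB (torusT (F.P K) 0) (fun κ z => unitsField (toUField W) ⟨z, κ⟩) (fun κ z => Complex.I • X ⟨z, κ⟩) x) j k‖ ^ 2))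
                  + B₃' * (((F.L : ℝ) ^ (K - n)) ^ 2)⁻¹ * (∑ b : PBond (F.P K) 0, ‖X b‖ ^ 2)) * (F.L : ℝ) ^ l) :
    ∀ (L : ℕ), 1 < L → ∀ (B₁' : ℝ), 0 < B₁' → ∃ eD CD₁ CD₂ : ℝ, 0 < eD ∧ 0 ≤ CD₁ ∧ 0 ≤ CD₂ ∧
      ∀ (F : T3Family), F.L = L → ∀ (n K : ℕ) (hnK : n < K) (e : ℝ) (V : GaugeField (F.P n) 0 (Matrix.specialUnitaryGroup (Fin 2) ℂ))
        (W : GaugeField (F.P K) 0 (Matrix.specialUnitaryGroup (Fin 2) ℂ)) (X : PBond (F.P K) 0 → Matrix (Fin 2) (Fin 2) ℂ),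
        0 < e → e ≤ eD → W ∈ regFibrePr F n K hnK.le e V →
        (∀ γ : ℝ → GaugeField (F.P K) 0 (Matrix.specialUnitaryGroup (Fin 2) ℂ), γ 0 = W → (∀ t, γ t ∈ fibre F ℰp n K hnK.le V) →
          (∀ b, DifferentiableAt ℝ (fun t => ((γ t b : Matrix.specialUnitaryGroup (Fin 2) ℂ) : Matrix (Fin 2) (Fin 2) ℂ)) 0) →
            deriv (fun t => wilsonAction4 (γ t)) 0 = 0) →
        In19 F n K (2 * B₁' * e) W (expHermField X) X → AvgCondPrint F n K hnK.le V W X → IsLandauPrint F n K W X →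
          ∑ ĉ : PBond (F.P n) 0, ‖CmapTw F n K hnK.le W (fun b => Complex.I • X b) ĉ - CmapTwS F n K hnK.le W (fun b => Complex.I • X b) ĉ‖
              ≤ CD₁ * ((F.L : ℝ) ^ (K - n))⁻¹ * (∑ b : PBond (F.P K) 0, ‖X b‖ ^ 2) + CD₂ * ((F.L : ℝ) ^ (K - n)) * ((∑ p : Plaq (F.P K) 0, ‖((Complex.I • X ⟨p.src, p.μ⟩) + ((W ⟨p.src, p.μ⟩ : Matrix (Fin 2) (Fin 2) ℂ) * (Complex.I • X ⟨p.src.shift p.μ, p.ν⟩) * star (W ⟨p.src, p.μ⟩ : Matrix (Fin 2) (Fin 2) ℂ))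
            - (((W ⟨p.src, p.μ⟩ * W ⟨p.src.shift p.μ, p.ν⟩ * (W ⟨p.src.shift p.ν, p.μ⟩)⁻¹ : Matrix.specialUnitaryGroup (Fin 2) ℂ) : Matrix (Fin 2) (Fin 2) ℂ) * (Complex.I • X ⟨p.src.shift p.ν, p.μ⟩) * star ((W ⟨p.src, p.μ⟩ * W ⟨p.src.shift p.μ, p.ν⟩ * (W ⟨p.src.shift p.ν, p.μ⟩)⁻¹ : Matrix.specialUnitaryGroup (Fin 2) ℂ) : Matrix (Fin 2) (Fin 2) ℂ))
            - (((GaugeField.plaqHol W p : Matrix.specialUnitaryGroup (Fin 2) ℂ) : Matrix (Fin 2) (Fin 2) ℂ) * (Complex.I • X ⟨p.src, p.ν⟩) * star ((GaugeField.plaqHol W p : Matrix.specialUnitaryGroup (Fin 2) ℂ) : Matrix (Fin 2) (Fin 2) ℂ)))‖ ^ 2) + (∑ x : Site (F.P K) 0, ∑ j : Fin 2, ∑ k : Fin 2,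
              ‖(divB (torusT (F.P K) 0) (fun κ z => unitsField (toUField W) ⟨z, κ⟩) (fun κ z => Complex.I • X ⟨z, κ⟩) x) j k‖ ^ 2)) :=
  hD_of_hMcomb_of_rem2Rows hMc (hRs_of_hN2s hN2s) (hRc_of_hMcomb_hMcomb₂ hMc hMc₂)

-- KERNEL WITNESS (no new content): ★p1 g18 ✓p700543 `hPA2_of_diffL1` consumes the conclusion as typed ⇒ the P-A2 binder from the three labelled rows.
example := fun hMc hMc₂ hN2s => Prop7HcoSOfNormG0DiffRow.hPA2_of_diffL1 (hD_of_hMcomb hMc hMc₂ hN2s)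

end Summit.QuantumFields.YangMills.Theorems.Prop7HDOfCombRows

end
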